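import Summits.FinalStateConjecture.FinalStateConjecture.Theorems.EIHFluxBalanceInertialRecessionStubRechart3Kinematics

/-!
# Route EIHFluxBalance — `InertialRecession`, re-charting: the painted centre world-line

Helper file for the crux `stmt-FinalStateConjecture-10166`
(`Summit.FinalStateConjecture.FinalStateConjecture.Theses.EIHFluxBalance.InertialRecession`),
line `sublinear-is-free-clean-window-charges`, stub `stub_rechart` (the transfer P2), part G1.

The centre world-line `c(t) = (t, ξ(t))` of a hole in lab coordinates (`centrePath`), its velocity
`c' = e₀ + (0, ξ')`, the identity `c' − u/u⁰ = (0, ξ' − ũ/u⁰)` relating the chart's velocity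
mismatch to the painted centre mismatch of third-order slaving (`deriv_centrePath_sub_normVel`),
and the decay of `(c' − u/u⁰)^{(m)}` (`m ≤ 2`) and of `c^{(m)}` (`m = 2, 3`) along a normalised
frame (`tendsto_iteratedDeriv_centreMismatch`, `tendsto_iteratedDeriv_centrePath`). [folklore]
-/

noncomputable section

set_option linter.dupNamespace false

open Set Filter Function Metric Topology
open scoped ContDiff
open Literature.Geometry.Lorentzian

namespace Summit.FinalStateConjecture.FinalStateConjecture.Theorems.SublinearIsFree.Rechart

/-! ### The painted centre world-line -/

/-- The painted centre world-line `c(t) = (t, ξ(t))` in lab coordinates. [folklore] -/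
def centrePath (ξ : ℝ → E3) (t : ℝ) : E4 := E4.ofTimeSpace t (ξ t)

/-- `c(t) = t e₀ + (0, ξ(t))`. [folklore] -/
theorem centrePath_eq (ξ : ℝ → E3) (t : ℝ) :
    centrePath ξ t = t • E4.basisVector 0 + E4.spaceEmbed (ξ t) := by
  rw [centrePath, E4.ofTimeSpace_eq_smul_add']

/-- `c'(t) = e₀ + (0, ξ'(t))`. [folklore] -/
theorem hasDerivAt_centrePath {ξ : ℝ → E3} {t : ℝ} {ξ' : E3} (h : HasDerivAt ξ ξ' t) :
    HasDerivAt (centrePath ξ) (E4.basisVector 0 + E4.spaceEmbed ξ') t := by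
  have h1 : HasDerivAt (fun t : ℝ ↦ t • E4.basisVector 0) ((1 : ℝ) • E4.basisVector 0) t :=
    (hasDerivAt_id t).smul_const _
  have h2 : HasDerivAt (fun t ↦ E4.spaceEmbed (ξ t)) (E4.spaceEmbed ξ') t :=
    E4.spaceEmbed.hasFDerivAt.comp_hasDerivAt t h
  have h3 := h1.add h2
  simp only [one_smul] at h3
  have heq : centrePath ξ = fun t ↦ t • E4.basisVector 0 + E4.spaceEmbed (ξ t) :=
    funext (centrePath_eq ξ)
  rw [heq]
  exact h3

/-- The centre world-line is smooth when `ξ` is. [folklore] -/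
theorem contDiff_centrePath {ξ : ℝ → E3} (hξ : ContDiff ℝ ∞ ξ) : ContDiff ℝ ∞ (centrePath ξ) := by
  have heq : centrePath ξ = fun t ↦ t • E4.basisVector 0 + E4.spaceEmbed (ξ t) :=
    funext (centrePath_eq ξ)
  rw [heq]
  exact (contDiff_id.smul contDiff_const).add (E4.spaceEmbed.contDiff.comp hξ)

/-- `deriv c = e₀ + (0, ξ')`. [folklore] -/
theorem deriv_centrePath {ξ : ℝ → E3} (hξ : Differentiable ℝ ξ) (t : ℝ) :
    deriv (centrePath ξ) t = E4.basisVector 0 + E4.spaceEmbed (deriv ξ t) :=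
  (hasDerivAt_centrePath (hξ t).hasDerivAt).deriv

/-- The normalised velocity in components: `u/u⁰ = e₀ + (0, ũ/u⁰)`. [folklore] -/
theorem normVel_eq (Λ : lorentzGroup) :
    normVel Λ = E4.basisVector 0 + E4.spaceEmbed (((frameVel Λ) 0)⁻¹ • E4.spatial (frameVel Λ)) := by
  have h := E4.ofTimeSpace_time_spatial (frameVel Λ)
  rw [E4.time_apply, E4.ofTimeSpace_eq_smul_add'] at h
  rw [normVel]
  nth_rw 2 [← h]
  rw [smul_add, smul_smul, inv_mul_cancel₀ (frameVel_zero_ne_zero Λ), one_smul, map_smul]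

/-- **The velocity mismatch of the chart**: `c'(t) − u/u⁰ = (0, ξ'(t) − ũ/u⁰)`, the painted centre
mismatch of the slaving hypothesis embedded as a spatial vector. [folklore] -/
theorem deriv_centrePath_sub_normVel {ξ : ℝ → E3} (hξ : Differentiable ℝ ξ) (Λ : lorentzGroup)
    (t : ℝ) : deriv (centrePath ξ) t - normVel Λ =
      E4.spaceEmbed (deriv ξ t - (((Λ : E4 ≃L[ℝ] E4) (E4.basisVector 0)) 0)⁻¹ •
        E4.spatial ((Λ : E4 ≃L[ℝ] E4) (E4.basisVector 0))) := by
  rw [deriv_centrePath hξ, normVel_eq, map_sub, frameVel]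
  abel

/-- **Decay of the chart's velocity mismatch and its derivatives** from third-order slaving:
`(c' − u/u⁰)^{(m)} → 0` for `m ≤ 2`. [folklore] -/
theorem tendsto_iteratedDeriv_centreMismatch {ξ : ℝ → E3} (hξ : ContDiff ℝ ∞ ξ)
    (Λ : ℝ → lorentzGroup) (hΛ : ContDiff ℝ ∞ (fun t ↦ ((Λ t : E4 ≃L[ℝ] E4) : E4 →L[ℝ] E4)))
    (hmis : ∀ m : ℕ, m ≤ 2 → Tendsto (fun t ↦ iteratedDeriv m (fun s ↦ deriv ξ s -
      ((((Λ s : E4 ≃L[ℝ] E4) (E4.basisVector 0)) 0)⁻¹ •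
        E4.spatial ((Λ s : E4 ≃L[ℝ] E4) (E4.basisVector 0)))) t) atTop (𝓝 0)) :
    ∀ m : ℕ, m ≤ 2 → Tendsto (fun t ↦ iteratedDeriv m
      (fun s ↦ deriv (centrePath ξ) s - normVel (Λ s)) t) atTop (𝓝 0) := by
  intro m hm
  have hd : Differentiable ℝ ξ := hξ.differentiable (by simp)
  have hsm : ContDiff ℝ ∞ (fun s ↦ deriv ξ s - ((((Λ s : E4 ≃L[ℝ] E4) (E4.basisVector 0)) 0)⁻¹ •
      E4.spatial ((Λ s : E4 ≃L[ℝ] E4) (E4.basisVector 0)))) := by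
    refine (hξ.deriv').sub ?_
    have h := contDiff_normVel Λ hΛ
    have h2 : ContDiff ℝ ∞ (fun s ↦ E4.spatial (normVel (Λ s))) := E4.spatial.contDiff.comp h
    have heq : (fun s ↦ ((((Λ s : E4 ≃L[ℝ] E4) (E4.basisVector 0)) 0)⁻¹ •
        E4.spatial ((Λ s : E4 ≃L[ℝ] E4) (E4.basisVector 0)))) = fun s ↦ E4.spatial (normVel (Λ s)) := by
      funext s
      rw [normVel, map_smul, frameVel]
    rw [heq]
    exact h2
  have heq : ∀ t, iteratedDeriv m (fun s ↦ deriv (centrePath ξ) s - normVel (Λ s)) t =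
      E4.spaceEmbed (iteratedDeriv m (fun s ↦ deriv ξ s -
        ((((Λ s : E4 ≃L[ℝ] E4) (E4.basisVector 0)) 0)⁻¹ •
          E4.spatial ((Λ s : E4 ≃L[ℝ] E4) (E4.basisVector 0)))) t) := by
    intro t
    rw [← iteratedDeriv_clm_comp E4.spaceEmbed hsm m t]
    congr 1
    funext s
    exact deriv_centrePath_sub_normVel hd (Λ s) s
  simp_rw [heq]
  have h' := (E4.spaceEmbed.continuous.tendsto 0).comp (hmis m hm)
  rw [map_zero] at h'
  exact h'

/-- **Decay of the higher derivatives of the centre world-line**: `c^{(m+1)} = (u/u⁰)^{(m)} +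
(c' − u/u⁰)^{(m)} → 0` for `m = 1, 2`. [folklore] -/
theorem tendsto_iteratedDeriv_centrePath {ξ : ℝ → E3} (hξ : ContDiff ℝ ∞ ξ)
    (Λ : ℝ → lorentzGroup) (hΛ : ContDiff ℝ ∞ (fun t ↦ ((Λ t : E4 ≃L[ℝ] E4) : E4 →L[ℝ] E4)))
    (hdec : ∀ m, 1 ≤ m → m ≤ 3 → Tendsto (fun t ↦ iteratedDeriv m
      (fun s ↦ ((Λ s : E4 ≃L[ℝ] E4) : E4 →L[ℝ] E4)) t) atTop (𝓝 0))
    {γ : ℝ} (hγ : ∀ t, |((Λ t : E4 ≃L[ℝ] E4) (E4.basisVector 0)) 0| ≤ γ)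
    (hpos : ∀ t, 0 < ((Λ t : E4 ≃L[ℝ] E4) (E4.basisVector 0)) 0)
    (hmis : ∀ m : ℕ, m ≤ 2 → Tendsto (fun t ↦ iteratedDeriv m (fun s ↦ deriv ξ s -
      ((((Λ s : E4 ≃L[ℝ] E4) (E4.basisVector 0)) 0)⁻¹ •
        E4.spatial ((Λ s : E4 ≃L[ℝ] E4) (E4.basisVector 0)))) t) atTop (𝓝 0)) :
    ∀ m : ℕ, 1 ≤ m → m ≤ 2 →
      Tendsto (fun t ↦ iteratedDeriv (m + 1) (centrePath ξ) t) atTop (𝓝 0) := by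
  intro m hm1 hm2
  have hc : ContDiff ℝ ∞ (centrePath ξ) := contDiff_centrePath hξ
  have hn : ContDiff ℝ ∞ (fun s ↦ normVel (Λ s)) := contDiff_normVel Λ hΛ
  have heq : ∀ t, iteratedDeriv (m + 1) (centrePath ξ) t =
      iteratedDeriv m (fun s ↦ normVel (Λ s)) t +
        iteratedDeriv m (fun s ↦ deriv (centrePath ξ) s - normVel (Λ s)) t := by
    intro t
    rw [iteratedDeriv_succ', ← iteratedDeriv_add]
    · congr 1
      funext s
      simp
    · exact (hn.of_le (by exact_mod_cast le_top)).contDiffAt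
    · exact ((hc.deriv'.sub hn).of_le (by exact_mod_cast le_top)).contDiffAt
  simp_rw [heq]
  have h1 := tendsto_iteratedDeriv_normVel Λ hΛ hdec hγ hpos m hm1 (by omega)
  have h2 := tendsto_iteratedDeriv_centreMismatch hξ Λ hΛ hmis m hm2
  simpa using h1.add h2

/-- Registered one-line form (worker carrier `rechart_deriv_centrePath_sub_normVel`) of
`deriv_centrePath_sub_normVel`, unfolded. [folklore] -/
theorem rechart_deriv_centrePath_sub_normVel : open Literature.Geometry.Lorentzian in ∀ {ξ : ℝ → E3}, Differentiable ℝ ξ → ∀ (Λ : lorentzGroup) (t : ℝ), deriv (fun s ↦ E4.ofTimeSpace s (ξ s)) t - (((Λ : E4 ≃L[ℝ] E4) (E4.basisVector 0)) 0)⁻¹ • (Λ : E4 ≃L[ℝ] E4) (E4.basisVector 0) = E4.spaceEmbed (deriv ξ t - (((Λ : E4 ≃L[ℝ] E4) (E4.basisVector 0)) 0)⁻¹ • E4.spatial ((Λ : E4 ≃L[ℝ] E4) (E4.basisVector 0))) := fun hξ Λ t ↦ by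
  have h := deriv_centrePath_sub_normVel hξ Λ t
  rwa [normVel, frameVel] at h

end Summit.FinalStateConjecture.FinalStateConjecture.Theorems.SublinearIsFree.Rechart

end
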